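import Literature.Geometry.Lorentzian.RedShiftedHorizon
import Literature.Geometry.Lorentzian.KillingHorizonShadowAlong
import Literature.Geometry.Lorentzian.KerrPhotonShellTurningPoints
import Literature.Geometry.Lorentzian.NearKerrLeaf
import Literature.Geometry.Lorentzian.BoundedGeometry
import HarnessLib

/-!
# Crux `GapExhaustion` (stmt-FinalStateConjecture-10808), line `photon-shell-pseudoconvexity`:
# the VOCABULARY of the rigidity node `EternalSilentNearKerrIsKerr` (route-posited objects)

Route `BartnikGapSettling`; definitions posited by the crux line `photon-shell-pseudoconvexity`
(crux skeleton `Cruxes/GapExhaustion/Lines/photon_shell_pseudoconvexity.lean`, leads a2–c12),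
moved VERBATIM out of the skeleton (rev c12c) so that the node's kernel-checked theorems (the
sweeps S3/S5 and the conditional extension S6b‴, so far workfile content) can be landed as
`Theorems/` modules and the skeleton stays under the workfile size cap. Contents: the two faces of
the Kerr photon shell `rPhMinus`/`rPhPlus` and the turning-point predicates
`PericentresBeyond`/`ApocentresBelow` (§1 of the skeleton); the eternal rest-frame Kerr-star
background `starBG`; the chart-relative regions `farZone`, `docOf`, `horizonOf`, `belowZone`,
`docOfChart`; the hypothesis bundle `FarSilentNearKerr`/`HorizonSilent`/`SilentEternalNearKerr`
(far/near silence in the time-uniform weighted `Cᵏ` sense; non-expanding horizon with surface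
gravity floor); the conclusion shape `IsExactKerrOnExterior`; and the Killing-field interfaces
`TimelikeKillingBeyond`, `HawkingPair`, `GlobalKillingPair`. No statement is new; docstrings are
the skeleton's. The node claim itself and the stub statements stay in the skeleton.
References: Ionescu–Klainerman, JAMS 26 (2013) / Surveys Diff. Geom. 20 (2015);
Alexakis–Ionescu–Klainerman, CMP 299 (2010); Dafermos–Rodnianski arXiv:0811.0354 §5.1 (Kerr-star
charts). [cite: IonescuKlainerman2013] [cite: IonescuKlainerman2015] [cite: DafermosRodnianski2008, §5.1]
-/

noncomputable section

-- D-0017: single-problem summit, `Summit.<S>.<S>.…` by design (cf. lakefile `weak.linter.dupNamespace`).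
set_option linter.dupNamespace false
-- instance search through the nested operator types `E4 →L[ℝ] E4 →L[ℝ] E4 →L[ℝ] ℝ`
set_option maxSynthPendingDepth 3

namespace Summit.FinalStateConjecture.FinalStateConjecture.Theorems.PhotonShellNode

open Literature.Geometry.Lorentzian
open Set Filter
open scoped Manifold ContDiff Topology ENNReal

/-- The RETROGRADE equatorial circular photon radius `r_ph⁻(M, a) = 2M(1 + cos(⅔ arccos(|a|/M)))
∈ [3M, 4M]` — the OUTER face of the photon shell (Bardeen–Press–Teukolsky 1972, (2.18);
`Kerr.photonOrbitRadius` evaluated at `|a|`, `Kerr.photonOrbitRadius_mem`). [folklore] -/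
def rPhMinus (M a : ℝ) : ℝ := Kerr.photonOrbitRadius M |a|

/-- The PROGRADE equatorial circular photon radius `r_ph⁺(M, a) = 2M(1 + cos(⅔ arccos(−|a|/M)))
∈ (M, 3M]` — the INNER face of the photon shell (the same closed form at spin `−|a|`,
`Kerr.photonOrbitRadius_neg_mem`). Both faces equal `3M` at `a = 0`. [folklore] -/
def rPhPlus (M a : ℝ) : ℝ := Kerr.photonOrbitRadius M (-|a|)

/-- **Every admissible null tangency beyond `ρ` is a pericentre**: `R(c) = 0 ⇒ R′(c) > 0` for all
non-trivial Θ-admissible constants (`Kerr.NullThetaAdmissible`) and all `c > ρ`, `R` the null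
radial Carter potential `Kerr.nullRadialPotential`. For `ρ = r_ph⁻(M,a)` this is the strong
pseudo-convexity, in the sense of Ionescu–Klainerman (arXiv:1108.3575, Def. 1.1), of every level
set `{r = c}`, `c > r_ph⁻`, with respect to its outer side `{r > c}` in exact Kerr. [folklore] -/
def PericentresBeyond (M a ρ : ℝ) : Prop :=
  ∀ E L Q c : ℝ, ρ < c → Kerr.NullThetaAdmissible a E L Q → (E ≠ 0 ∨ L ≠ 0 ∨ Q ≠ 0) →
    Kerr.nullRadialPotential M a E L Q c = 0 → 0 < deriv (Kerr.nullRadialPotential M a E L Q) c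

/-- **Every admissible null tangency strictly between the horizon and `ρ` is an apocentre**:
`R(c) = 0 ⇒ R′(c) < 0` for `r₊ < c < ρ`. For `ρ = r_ph⁺(M,a)` this is the strong
pseudo-convexity of `{r = c}`, `r₊ < c < r_ph⁺`, with respect to its INNER side `{r < c}` — for
every Killing energy, the zero- and negative-energy (ergoregion) geodesics included. [folklore] -/
def ApocentresBelow (M a ρ : ℝ) : Prop :=
  ∀ E L Q c : ℝ, Kerr.rPlus M a < c → c < ρ → Kerr.NullThetaAdmissible a E L Q →
    (E ≠ 0 ∨ L ≠ 0 ∨ Q ≠ 0) → Kerr.nullRadialPotential M a E L Q c = 0 →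
    deriv (Kerr.nullRadialPotential M a E L Q) c < 0


/-- The rest-frame Kerr-STAR background of label `(M, a)`: domain the horizon-penetrating star
region `{r_a(x) > max M 0} ⊆ E4` (all `t* ∈ ℝ` — this is what makes a chart on it ETERNAL),
reference form the Kerr–Schild form, clock `t* = x⁰`, radius the Kerr–Schild radius. Verbatim the
`starBackground` of the crux's collar clause at boost `1`, centre `0`. [folklore] -/
abbrev starBG (M a : ℝ) : ModelBackground := starBackground 1 0 M a (Kerr.radius a)

section Node

variable (𝓢 : Spacetime.{0} 4) (M a : ℝ) (Ψ : (starBG M a).domain → 𝓢.carrier)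

/-- The far zone `Ψ({r > R})` of the chart. [folklore] -/
def farZone (R : ℝ) : Set 𝓢.carrier := Ψ '' {x | R < Kerr.radius a x.1}

/-- The domain of outer communications seen by the chart: the chronological past of the
(strictly stationary, for near-Kerr metrics) zone `Ψ({r > 3M})`. [folklore] -/
def docOf : Set 𝓢.carrier :=
  𝓢.metric.chronologicalPast 𝓢.timeOrientation (farZone 𝓢 M a Ψ (3 * M))

/-- The future event horizon of the charted region: the boundary of `docOf` inside `range Ψ`. [folklore] -/
def horizonOf : Set 𝓢.carrier := frontier (docOf 𝓢 M a Ψ) ∩ range Ψ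

/-- The exterior part of the chart below radius `ρ`: `Ψ({r < ρ}) ∩ docOf`. [folklore] -/
def belowZone (ρ : ℝ) : Set 𝓢.carrier :=
  (Ψ '' {x | Kerr.radius a x.1 < ρ}) ∩ docOf 𝓢 M a Ψ

/-- The **charted domain of outer communications** `docOf ∩ range Ψ` (rev c12). `docOf = I⁻(far
zone)` itself is NOT contained in `range Ψ` in general (white-hole region of a maximal extension,
where the bundle assumes nothing beyond Ricci-flatness), so no stub may conclude Killing-ness on
`docOf`; this is the set used by `GlobalKillingPair`, S6a, S6b since rev c12 (`RESHAPE-c12.md`). [folklore] -/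
def docOfChart : Set 𝓢.carrier := docOf 𝓢 M a Ψ ∩ range Ψ

variable [𝓢.metric.HasLeviCivita]

/-- **Far/near silence in one clause.** `𝓢` is Ricci-flat, `Ψ` is a smooth open embedding of
the WHOLE eternal star domain, and the pulled-back metric is `δ`-close to the Kerr–Schild form of
`(M, a)` in the time-uniform weighted `Cᵏ` sense `r^{j+1} ‖Dʲ(Ψ^*g − g_{M,a})‖ ≤ δ M`
(`j ≤ k`) on the whole domain. At `j ≤ 2` the weight forbids outgoing AND incoming radiation
fields at every retarded/advanced time (eternity + uniformity), so this is nearness +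
asymptotic flatness + zero news towards `𝓘⁺` and `𝓘⁻`; on the collar `{r ≤ 4M}` it is plain
`Cᵏ`-closeness with tolerance `~δ`, hence two-sided control of the metric there. [folklore] -/
def FarSilentNearKerr (k : ℕ) (δ : ℝ) : Prop :=
  𝓢.metric.toPseudoRiemannianMetric.IsRicciFlat ∧
  ContMDiff 𝓘(ℝ, E4) (𝓡 4) ∞ Ψ ∧ Topology.IsOpenEmbedding Ψ ∧
  ∀ (x : (starBG M a).domain) (j : ℕ), j ≤ k →
    Kerr.radius a x.1 ^ (j + 1) * ‖iteratedFDeriv ℝ j (𝓢.deviationExtend (starBG M a) Ψ) x.1‖ ≤ δ * M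

/-- **Horizon silence.** The event horizon `𝓗 = horizonOf` of the charted region has surface
gravity `≥ κ₀` in the clock `t` (`LorentzianMetric.HasSurfaceGravityGe`: a future null
pregeodesic generator field `L`, `dt(L) = 1`, `∇_L L = κL`, `κ ≥ κ₀`, `𝓗` forward-invariant), and
`𝓗` is NON-EXPANDING for all times: some nowhere-zero null generator field `L'` leaving `𝓗`
invariant has vanishing null second fundamental form, `g(∇_X L', Y) = 0` for all `X, Y ⊥ L'`
(`θ = σ = 0`; equivalently `𝓗` is totally geodesic). On an `ω`-limit both come from the area law
+ bounded final area and from the collar margin `κ ≥ κ₀(χ) > 0` (triage: NEH is load-bearing —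
without it "Kerr + one incoming packet" is an eternal bounded non-stationary witness). [folklore] -/
def HorizonSilent (κ₀ : ℝ) (t : 𝓢.carrier → ℝ) : Prop :=
  𝓢.metric.HasSurfaceGravityGe 𝓢.timeOrientation (horizonOf 𝓢 M a Ψ) t κ₀ ∧
  ∃ L' : Π x : 𝓢.carrier, TangentSpace (𝓡 4) x,
    (∃ 𝒩 : Set 𝓢.carrier, IsOpen 𝒩 ∧ horizonOf 𝓢 M a Ψ ⊆ 𝒩 ∧
      ContMDiffOn (𝓡 4) ((𝓡 4).prod 𝓘(ℝ, E4)) ∞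
        (fun x ↦ (Bundle.TotalSpace.mk' E4 x (L' x) : TangentBundle (𝓡 4) 𝓢.carrier)) 𝒩) ∧
    (∀ p ∈ horizonOf 𝓢 M a Ψ, L' p ≠ 0 ∧ 𝓢.metric.IsNull (L' p)) ∧
    (∀ (γ : ℝ → 𝓢.carrier) (s₁ s₂ : ℝ), s₁ ≤ s₂ → IsMIntegralCurveOn γ L' (Icc s₁ s₂) →
      γ s₁ ∈ horizonOf 𝓢 M a Ψ → γ s₂ ∈ horizonOf 𝓢 M a Ψ) ∧
    ∀ p ∈ horizonOf 𝓢 M a Ψ, ∀ X Y : TangentSpace (𝓡 4) p,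
      𝓢.metric.val p X (L' p) = 0 → 𝓢.metric.val p Y (L' p) = 0 →
        𝓢.metric.val p (𝓢.metric.leviCivita L' p X) Y = 0

/-- **The hypothesis bundle of the node**: far/near silence at tolerance `δ` and order `k`, the
clock `t` is Kerr-star time read through the chart, and horizon silence with floor `κ₀`. [folklore] -/
def SilentEternalNearKerr (k : ℕ) (δ κ₀ : ℝ) (t : 𝓢.carrier → ℝ) : Prop :=
  FarSilentNearKerr 𝓢 M a Ψ k δ ∧ (∀ x, t (Ψ x) = (starBG M a).time x.1) ∧
    HorizonSilent 𝓢 M a Ψ κ₀ t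

omit [𝓢.metric.HasLeviCivita] in
variable {𝓢 M a Ψ} in
/-- The far/near clause is monotone: a larger tolerance and a lower order are weaker. [folklore] -/
theorem FarSilentNearKerr.mono [𝓢.metric.HasLeviCivita] {k k' : ℕ} {δ δ' : ℝ}
    (h : FarSilentNearKerr 𝓢 M a Ψ k δ) (hk : k' ≤ k) (hδ : δ ≤ δ') (hM : 0 ≤ M) :
    FarSilentNearKerr 𝓢 M a Ψ k' δ' :=
  ⟨h.1, h.2.1, h.2.2.1,
    fun x j hj ↦ (h.2.2.2 x j (hj.trans hk)).trans (mul_le_mul_of_nonneg_right hδ hM)⟩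

omit [𝓢.metric.HasLeviCivita] in
variable {𝓢 M a Ψ} in
/-- The hypothesis bundle is monotone in order and tolerance. [folklore] -/
theorem SilentEternalNearKerr.mono [𝓢.metric.HasLeviCivita] {k k' : ℕ} {δ δ' κ₀ : ℝ}
    {t : 𝓢.carrier → ℝ} (h : SilentEternalNearKerr 𝓢 M a Ψ k δ κ₀ t) (hk : k' ≤ k)
    (hδ : δ ≤ δ') (hM : 0 ≤ M) : SilentEternalNearKerr 𝓢 M a Ψ k' δ' κ₀ t :=
  ⟨h.1.mono hk hδ hM, h.2.1, h.2.2⟩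

/-- A Killing field `T` on the far zone `Ψ({r > R})` which is timelike there (the scri-side
stationarity produced by ignition at infinity). [folklore] -/
def TimelikeKillingBeyond (T : Π x : 𝓢.carrier, TangentSpace (𝓡 4) x) (R : ℝ) : Prop :=
  𝓢.metric.toPseudoRiemannianMetric.IsKillingFieldOn T (farZone 𝓢 M a Ψ R) ∧
    ∀ x : (starBG M a).domain, R < Kerr.radius a x.1 → 𝓢.metric.val (Ψ x) (T (Ψ x)) (T (Ψ x)) < 0

/-- A **Hawking pair** `(K, V)`: `V` is an open two-sided neighbourhood of the horizon and `K` a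
Killing field on `V`, non-zero and null along `𝓗` (the horizon-side stationarity produced by
ignition at the horizon). [folklore] -/
def HawkingPair (K : Π x : 𝓢.carrier, TangentSpace (𝓡 4) x) (V : Set 𝓢.carrier) : Prop :=
  IsOpen V ∧ horizonOf 𝓢 M a Ψ ⊆ V ∧ 𝓢.metric.toPseudoRiemannianMetric.IsKillingFieldOn K V ∧
    ∀ p ∈ horizonOf 𝓢 M a Ψ, K p ≠ 0 ∧ 𝓢.metric.IsNull (K p)

end Node

/-- **Exactly Kerr on the exterior of the charted region (rev a2; replaces the all-domain
`IsExactKerrOn`, which is FALSE on left-perturbed maximal Kerr — §0, "Changes by line lead a2").**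
The chart can be re-chosen on the same eternal star domain — a smooth open embedding `Φ` with
`range Φ = range Ψ` — so that AT EVERY RE-CHARTED POINT OF THE CLOSED DOMAIN OF OUTER
COMMUNICATIONS `closure docOf` (exterior and event horizon) the pulled-back metric IS the
Kerr–Schild form of a sub-extremal label `(M', a')` with `|M' − M| ≤ M/8`, `|a' − a| ≤ M/8`
(`g_{M',a'}` is smooth on `{r_a > M}`: that set misses the disc `{z = 0, ϱ² ≤ a'²}`). No claim is
made on the interior strip `Φ⁻¹(range Ψ ∖ closure docOf)`, where `Φ` is only a diffeomorphic
extension (its existence across the horizon is part of the burden of S7: AIK-type rigidity with a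
two-sided Hawking pair gives the isometry on `docOf ∪ V`, `V` two-sided, and the rest is collar
extension of a diffeomorphism). A consumer cuts its exact EXTERIOR collar `{r'₊ ≤ r ≤ 3M'}` out of
`Φ` and controls the interior piece `{M' < r < r'₊}` of a thick collar separately (closeness of
horizon data over a long window + red-shift read-back — closeness, not exactness, is what the
restated crux asks). [folklore] -/
def IsExactKerrOnExterior (𝓢 : Spacetime.{0} 4) (M a : ℝ)
    (Ψ : (starBG M a).domain → 𝓢.carrier) : Prop :=
  ∃ (M' a' : ℝ) (Φ : (starBG M a).domain → 𝓢.carrier),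
    |M' - M| ≤ M / 8 ∧ |a' - a| ≤ M / 8 ∧ |a'| < M' ∧
    ContMDiff 𝓘(ℝ, E4) (𝓡 4) ∞ Φ ∧ Topology.IsOpenEmbedding Φ ∧ range Φ = range Ψ ∧
    ∀ x, Φ x ∈ closure (docOf 𝓢 M a Ψ) →
      𝓢.chartMetric (starBG M a) Φ x = (starBG M' a').bilin x.1

/-- **Global Killing pair**: a Hawking pair `(K, V)` with `K` Killing on `docOfChart ∪ V`, and a
field `T` Killing on `docOfChart ∪ V` and timelike beyond some radius — the input of perturbative
rigidity (rev c12: the CHARTED d.o.c. replaces `docOf`, see `docOfChart`; S7 concerns the charted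
exterior only, so nothing downstream used the overreach). [folklore] -/
def GlobalKillingPair (𝓢 : Spacetime.{0} 4) [𝓢.metric.HasLeviCivita] (M a : ℝ)
    (Ψ : (starBG M a).domain → 𝓢.carrier) : Prop :=
  ∃ (T K : Π x : 𝓢.carrier, TangentSpace (𝓡 4) x) (V : Set 𝓢.carrier) (R : ℝ),
    HawkingPair 𝓢 M a Ψ K V ∧
    𝓢.metric.toPseudoRiemannianMetric.IsKillingFieldOn K (docOfChart 𝓢 M a Ψ ∪ V) ∧
    𝓢.metric.toPseudoRiemannianMetric.IsKillingFieldOn T (docOfChart 𝓢 M a Ψ ∪ V) ∧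
    TimelikeKillingBeyond 𝓢 M a Ψ T R

/-- `belowZone` is monotone in the radius (registration handle of this vocabulary file). [folklore] -/
theorem belowZone_mono : ∀ (𝓢 : Spacetime.{0} 4) (M a : ℝ) (Ψ : (starBG M a).domain → 𝓢.carrier) (ρ ρ' : ℝ), ρ ≤ ρ' → belowZone 𝓢 M a Ψ ρ ⊆ belowZone 𝓢 M a Ψ ρ' := by
  rintro 𝓢 M a Ψ ρ ρ' h p ⟨⟨x, hx, rfl⟩, hp⟩
  exact ⟨⟨x, lt_of_lt_of_le hx h, rfl⟩, hp⟩

end Summit.FinalStateConjecture.FinalStateConjecture.Theorems.PhotonShellNode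

end
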